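/-
Copyright (c) 2026 the pub-hodgecm-mathlib formalisation cell (harness21).  Prover seat hodgecm-mathlib-F0P3a-p09 (g15); E1 keeper ∕ dealer F0P3a-p03 (g30), E1 BRICK
LEDGER row 56-B3(53) «TAME TWIN OF ★ 53-datum» (LEAD T15-42 (iii): twins of ★ files by the file's own pen; keeper deal 2026-09-03T03:34:03Z).
-/
import Summits.HodgeConjecture.HodgeConjecture.Theorems.F0P3cStCharTSEllipticFixedTree       -- ★ 53 (this seat) p853423: the six PLACE-FREE heads are used BY NAME (§1 `isOpen_setOf_act_apply_eq`, §2 stabilisers ∕ finite `Z(γ)`-orbit, §3 per-orbit finiteness, §4 fixed edges, (d2))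
import Literature.NumberTheory.Automorphic.UnitaryLatticeTreeFramesOfInvolution               -- ★ `isTree_latticeGraph_three_of_neg`, `exists_frame_mapGL_stdLattice`; brings ★ `…SelfDualTransitiveTame` (`…_of_v_two`) and ★ `…TypeTwoTransitiveRamified` (`…_of_neg`)
import Literature.NumberTheory.Automorphic.UnitaryLatticeTreeStarOfInvolution                 -- ★ `isSelfDualLattice_stdLattice_three_of_v`
import Literature.NumberTheory.Automorphic.UnitaryLatticeTreeApartmentOfInvolution            -- ★ `isVertexLattice_two_N₁_of_v`
import HarnessLib

/-!
# Row 56-B3(53) — THE TAME TWIN: a regular elliptic `γ` has a non-empty finite fixed tree, WITHOUT the unramified datum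

Cell `pub/hodgecm-mathlib`, crux H413 = `stmt-HodgeConjecture-24833` (`--supports` lane, helper, THEOREMS ONLY: no definition ∕ instance ∕ notation ∕ named fact ∕ `sorry`).
Namespace `Summit.HodgeConjecture.HodgeConjecture.Cruxes.H413.F0P3cStCharTSEllipticFixedTreeRamified`.  Sibling of ★ `…F0P3cStCharTSEllipticFixedTree` (row 53, p853423): the SAME
heads with the suffix `_of_involution` (place letters hypothesis-style: `hvσ hϖ`, tree-ness `hT`, the two vertex-orbit transitivities `htr₀ htr₂`) and `_of_neg` (TAME dischargers:
`hσ hvσ hϖ hσϖ hres h2 hnorm`, ★ `isTree_latticeGraph_three_of_neg`, ★ `exists_unitary_mapGL_stdLattice_eq_of_isSelfDualLattice_of_v_two`, ★ `forall_isVertexLattice_two_exists_mapGL_N₁_eq_of_neg`);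
conclusions VERBATIM.  The six heads of ★ 53 that never read `hd` (§1, §2, §3 per orbit, §4, (d2)) are used BY NAME, not re-issued.  E1 BRICK LEDGER row 56-B3 (keeper F0P3a-p03 (g30)
03:34:03Z; census 03:35:03Z).  HONEST LABEL: count-neutral datum helper; TAME road GO-LOW (LEAD T15-42); WILD (dyadic) places stay PRINT (`h2 : |2| = 1` is a binder);
E1 = PRINT until the keeper's charter test + LEAD words; HC_CM is proved only modulo the 7 printed citations (2 remaining named inputs hLiu418 = stmt-HodgeConjecture-24832,
h413 = stmt-HodgeConjecture-24833) until rung 0 closes.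

THE MATHEMATICS is ★ 53's (Kottwitz 1986 §3; Serre *Trees* I.6.5; Bruhat–Tits 1972 §10; Rogawski 1990 §12.5): `hne` by TITS on the finite `Z(γ)`-orbit + NO INVERSION (the type colouring
needs only `|σ a| = |a|` and `|ϖ| = q⁻¹`); `hfin` by the ORBIT METHOD on the two vertex orbits (types `0`, `2` ★ `type_eq_zero_or_two_of_isVertexLattice_three`), whose base points
`L₀ = 𝒪³` and `N₁ = latt diag(1,1,ϖ)` are vertices at every place (★ `isSelfDualLattice_stdLattice_three_of_v`, ★ `isVertexLattice_two_N₁_of_v`) and whose transitivity is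
`htr₀ ∕ htr₂` — ★ at tame ramified places by the `_of_v_two` ∕ `_of_neg` theorems.

## References
* [Kottwitz1986] R. Kottwitz, *Base change for unit elements of Hecke algebras*, Compositio Math. 60 (1986), §3.
* [Serre1980Trees] J.-P. Serre, *Trees* (1980), I.6.5 Prop. 26, II.1.1.
* [BruhatTits1972] F. Bruhat, J. Tits, *Groupes réductifs sur un corps local I*, Publ. Math. IHÉS 41 (1972), §10.
* [Rogawski1990] J. D. Rogawski, *Automorphic Representations of Unitary Groups in Three Variables* (1990), §3.6, §12.5 pp. 182–187.
-/

set_option autoImplicit false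

set_option linter.dupNamespace false

noncomputable section

open NumberField IsDedekindDomain MeasureTheory
open scoped Pointwise Valued WithZero Matrix
open Literature.NumberTheory.Rogawski1990 Literature.NumberTheory.Rogawski1990.Ch12Sec5
open Literature.NumberTheory.Automorphic Literature.NumberTheory.Automorphic.UnitaryGroup Literature.NumberTheory.Automorphic.UnitaryLatticeTree
open Literature.NumberTheory.Automorphic.HermitianLattice
open Literature.Combinatorics.SimpleGraph Literature.Combinatorics.SimpleGraph.OrientedIncidence

namespace Summit.HodgeConjecture.HodgeConjecture.Cruxes.H413.F0P3cStCharTSEllipticFixedTreeRamified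

open Summit.HodgeConjecture.HodgeConjecture.Cruxes.H413
open F0P3cStCharTSCharacterEllipticUniform F0P3cStCharTSTorusDefs F0P3cStCharTSEllipticFixedTree

section Datum

variable (L : Type) [Field L] [NumberField L] [IsCMField L] (v : HeightOneSpectrum (𝓞 ↥(maximalRealSubfield L)))
  (w : PlacesOver L v) (hw : IsCMField.complexConj L • w.1 = w.1) {ϖ : w.1.adicCompletion L}
  (eA : Gqs L v ≃ₜ* ↥(unitaryGroupOfForm (galAdicCompletionMap (L := L) (IsCMField.complexConj L) hw) ((StdForm.antidiagonal 3).over (w.1.adicCompletion L))))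
  {a : Gqs L v →* ((latticeGraph (galAdicCompletionMap (L := L) (IsCMField.complexConj L) hw) ϖ ((StdForm.antidiagonal 3).over (w.1.adicCompletion L))) ≃g (latticeGraph (galAdicCompletionMap (L := L) (IsCMField.complexConj L) hw) ϖ ((StdForm.antidiagonal 3).over (w.1.adicCompletion L))))}
  (ha : ∀ g, a g = latticeGraphIso (galAdicCompletionMap (L := L) (IsCMField.complexConj L) hw) ϖ ((StdForm.antidiagonal 3).over (w.1.adicCompletion L)) (eA g))

/-! ## §1 Hypothesis-style place letters (`_of_involution`) -/

include ha in
/-- **`hne`, PLACE LETTERS HYPOTHESIS-STYLE**: if the lattice graph is a tree (`hT`), `|σ ·| = |·|` and `|ϖ| = q⁻¹`, and `Z(γ)` is compact, then `γ` fixes a vertex — ★ 53's proof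
with the base vertex `L₀ = 𝒪³` (★ `isSelfDualLattice_stdLattice_three_of_v`). [cite: Serre1980Trees, I.6.5 Prop. 26] [cite: BruhatTits1972, §10] [cite: Kottwitz1986, §3] -/
theorem exists_apply_eq_self_of_isCompact_centralizer_of_involution (hvσ : ∀ x, Valued.v ((galAdicCompletionMap (L := L) (IsCMField.complexConj L) hw) x) = Valued.v x) (hϖ : Valued.v ϖ = WithZero.exp (-1 : ℤ))
    (hT : (latticeGraph (galAdicCompletionMap (L := L) (IsCMField.complexConj L) hw) ϖ ((StdForm.antidiagonal 3).over (w.1.adicCompletion L))).IsTree) {γ : Gqs L v} (hZc : IsCompact ((Subgroup.centralizer ({γ} : Set (Gqs L v))) : Set (Gqs L v))) : ∃ o, a γ o = o := by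
  -- the base vertex `L₀` and the finite `γ`-invariant set `S = Z(γ) · L₀`
  have o₀ : {M : Submodule 𝒪[(w.1.adicCompletion L)] (Fin 3 → (w.1.adicCompletion L)) // IsVertex (galAdicCompletionMap (L := L) (IsCMField.complexConj L) hw) ϖ ((StdForm.antidiagonal 3).over (w.1.adicCompletion L)) M} := ⟨stdLattice (w.1.adicCompletion L) 3, 0, isSelfDualLattice_stdLattice_three_of_v hϖ⟩
  have hS := finite_image_centralizer_apply L v w hw eA ha hZc o₀
  have hSne : ((fun c : Gqs L v => a c o₀) '' ((Subgroup.centralizer ({γ} : Set (Gqs L v))) : Set (Gqs L v))).Nonempty := ⟨a 1 o₀, 1, Subgroup.one_mem _, rfl⟩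
  have hγZ : γ ∈ Subgroup.centralizer ({γ} : Set (Gqs L v)) := Subgroup.mem_centralizer_singleton_iff.2 rfl
  have hαS : ∀ s ∈ (fun c : Gqs L v => a c o₀) '' ((Subgroup.centralizer ({γ} : Set (Gqs L v))) : Set (Gqs L v)), a γ s ∈ (fun c : Gqs L v => a c o₀) '' ((Subgroup.centralizer ({γ} : Set (Gqs L v))) : Set (Gqs L v)) := by
    rintro _ ⟨c, hc, rfl⟩
    refine ⟨γ * c, Subgroup.mul_mem _ hγZ hc, ?_⟩
    simp only [map_mul]
    rfl
  rcases RootedTree.exists_fixed_or_swap_adj_of_finite_invariant hT (a γ) hS hSne hαS with h | ⟨u, u', hadj, hu, hu'⟩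
  · exact h
  · exfalso
    obtain ⟨C, -, hC⟩ := exists_coloring_type hvσ hϖ ((StdForm.antidiagonal 3).over (w.1.adicCompletion L))
    have h1 : C u' = C u := by rw [← hu, ha]; exact hC (eA γ) u
    exact C.valid hadj h1.symm

set_option maxHeartbeats 800000 in
include ha in
/-- **`hfin`, PLACE LETTERS HYPOTHESIS-STYLE**: with the two vertex-orbit transitivities `htr₀` (self-dual vertices are `u·L₀`) and `htr₂` (type-two vertices are `u·N₁`) as
hypotheses, the `γ`-fixed vertex set of a regular `γ` with compact centraliser is finite — ★ 53 §3 per orbit, the types by ★ `type_eq_zero_or_two_of_isVertexLattice_three`.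
[cite: Kottwitz1986, §3] [cite: BruhatTits1972, §10] [cite: Rogawski1990, §12.5 pp. 182–184] -/
theorem finite_setOf_apply_eq_self_of_isCompact_centralizer_of_involution (hvσ : ∀ x, Valued.v ((galAdicCompletionMap (L := L) (IsCMField.complexConj L) hw) x) = Valued.v x) (hϖ : Valued.v ϖ = WithZero.exp (-1 : ℤ))
    (htr₀ : ∀ M : Submodule 𝒪[(w.1.adicCompletion L)] (Fin 3 → (w.1.adicCompletion L)), IsSelfDualLattice (galAdicCompletionMap (L := L) (IsCMField.complexConj L) hw) ϖ ((StdForm.antidiagonal 3).over (w.1.adicCompletion L)) M → ∃ u : ↥(unitaryGroupOfForm (galAdicCompletionMap (L := L) (IsCMField.complexConj L) hw) ((StdForm.antidiagonal 3).over (w.1.adicCompletion L))), M = mapGL (u : GL (Fin 3) (w.1.adicCompletion L)) (stdLattice (w.1.adicCompletion L) 3))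
    (htr₂ : ∀ M : Submodule 𝒪[(w.1.adicCompletion L)] (Fin 3 → (w.1.adicCompletion L)), IsVertexLattice (galAdicCompletionMap (L := L) (IsCMField.complexConj L) hw) ϖ ((StdForm.antidiagonal 3).over (w.1.adicCompletion L)) 2 M → ∃ u : ↥(unitaryGroupOfForm (galAdicCompletionMap (L := L) (IsCMField.complexConj L) hw) ((StdForm.antidiagonal 3).over (w.1.adicCompletion L))), M = mapGL (u : GL (Fin 3) (w.1.adicCompletion L)) (latt (Matrix.diagonal ![(1 : (w.1.adicCompletion L)), 1, ϖ])))
    {γ : Gqs L v} (hreg : IsRegularElt (γ.val : GL (Fin 3) (LocalRing L v))) (hZc : IsCompact ((Subgroup.centralizer ({γ} : Set (Gqs L v))) : Set (Gqs L v))) :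
    {x : {M : Submodule 𝒪[(w.1.adicCompletion L)] (Fin 3 → (w.1.adicCompletion L)) // IsVertex (galAdicCompletionMap (L := L) (IsCMField.complexConj L) hw) ϖ ((StdForm.antidiagonal 3).over (w.1.adicCompletion L)) M} | a γ x = x}.Finite := by
  have hϖ0 : ϖ ≠ 0 := CartanUnique.uniformizer_ne_zero hϖ
  have hϖ1 : Valued.v ϖ ≤ 1 := by rw [hϖ]; exact le_of_lt (WithZero.exp_lt_exp.2 (by norm_num))
  let x₀ : {M : Submodule 𝒪[(w.1.adicCompletion L)] (Fin 3 → (w.1.adicCompletion L)) // IsVertex (galAdicCompletionMap (L := L) (IsCMField.complexConj L) hw) ϖ ((StdForm.antidiagonal 3).over (w.1.adicCompletion L)) M} := ⟨stdLattice (w.1.adicCompletion L) 3, 0, isSelfDualLattice_stdLattice_three_of_v hϖ⟩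
  let x₂ : {M : Submodule 𝒪[(w.1.adicCompletion L)] (Fin 3 → (w.1.adicCompletion L)) // IsVertex (galAdicCompletionMap (L := L) (IsCMField.complexConj L) hw) ϖ ((StdForm.antidiagonal 3).over (w.1.adicCompletion L)) M} := ⟨latt (Matrix.diagonal ![(1 : (w.1.adicCompletion L)), 1, ϖ]), 2, isVertexLattice_two_N₁_of_v hvσ hϖ1 hϖ0⟩
  refine ((finite_setOf_apply_eq_self_of_mem_orbit L v w hw eA ha hreg hZc x₀).union
    (finite_setOf_apply_eq_self_of_mem_orbit L v w hw eA ha hreg hZc x₂)).subset ?_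
  intro x hx
  obtain ⟨d, hxd⟩ := x.2
  rcases type_eq_zero_or_two_of_isVertexLattice_three hvσ hϖ v_det_antidiagonal_three hxd with rfl | rfl
  · obtain ⟨u, hxu⟩ := htr₀ x.1 hxd
    refine Or.inl ⟨hx, eA.symm u, ?_⟩
    rw [ha, ContinuousMulEquiv.apply_symm_apply]
    exact Subtype.ext hxu.symm
  · obtain ⟨u, hxu⟩ := htr₂ x.1 hxd
    refine Or.inr ⟨hx, eA.symm u, ?_⟩
    rw [ha, ContinuousMulEquiv.apply_symm_apply]
    exact Subtype.ext hxu.symm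

include ha in
/-- **`hne` FOR A REGULAR `γ ∉ Ω`, place letters hypothesis-style.** [cite: Rogawski1990, §12.5 p. 184; §3.6 pp. 28–31] [cite: Serre1980Trees, I.6.5 Prop. 26] -/
theorem exists_apply_eq_self_of_not_mem_hyperbolicSet_of_involution (hns : ∀ w' : PlacesOver L v, IsCMField.complexConj L • w'.1 = w'.1) (hvσ : ∀ x, Valued.v ((galAdicCompletionMap (L := L) (IsCMField.complexConj L) hw) x) = Valued.v x) (hϖ : Valued.v ϖ = WithZero.exp (-1 : ℤ))
    (hT : (latticeGraph (galAdicCompletionMap (L := L) (IsCMField.complexConj L) hw) ϖ ((StdForm.antidiagonal 3).over (w.1.adicCompletion L))).IsTree) {γ : Gqs L v} (hreg : IsRegularElt (γ.val : GL (Fin 3) (LocalRing L v))) (hΩ : γ ∉ hyperbolicSet L v) : ∃ o, a γ o = o :=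
  exists_apply_eq_self_of_isCompact_centralizer_of_involution L v w hw eA ha hvσ hϖ hT
    (F0P3cStCharTSEllCartanCompact.isCompact_centralizer_of_not_mem_hyperbolicSet L v hns hreg hΩ)

include ha in
/-- **`hfin` FOR A REGULAR `γ ∉ Ω`, place letters hypothesis-style.** [cite: Kottwitz1986, §3] [cite: Rogawski1990, §12.5 pp. 182–184] -/
theorem finite_setOf_apply_eq_self_of_not_mem_hyperbolicSet_of_involution (hns : ∀ w' : PlacesOver L v, IsCMField.complexConj L • w'.1 = w'.1) (hvσ : ∀ x, Valued.v ((galAdicCompletionMap (L := L) (IsCMField.complexConj L) hw) x) = Valued.v x) (hϖ : Valued.v ϖ = WithZero.exp (-1 : ℤ))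
    (htr₀ : ∀ M : Submodule 𝒪[(w.1.adicCompletion L)] (Fin 3 → (w.1.adicCompletion L)), IsSelfDualLattice (galAdicCompletionMap (L := L) (IsCMField.complexConj L) hw) ϖ ((StdForm.antidiagonal 3).over (w.1.adicCompletion L)) M → ∃ u : ↥(unitaryGroupOfForm (galAdicCompletionMap (L := L) (IsCMField.complexConj L) hw) ((StdForm.antidiagonal 3).over (w.1.adicCompletion L))), M = mapGL (u : GL (Fin 3) (w.1.adicCompletion L)) (stdLattice (w.1.adicCompletion L) 3))
    (htr₂ : ∀ M : Submodule 𝒪[(w.1.adicCompletion L)] (Fin 3 → (w.1.adicCompletion L)), IsVertexLattice (galAdicCompletionMap (L := L) (IsCMField.complexConj L) hw) ϖ ((StdForm.antidiagonal 3).over (w.1.adicCompletion L)) 2 M → ∃ u : ↥(unitaryGroupOfForm (galAdicCompletionMap (L := L) (IsCMField.complexConj L) hw) ((StdForm.antidiagonal 3).over (w.1.adicCompletion L))), M = mapGL (u : GL (Fin 3) (w.1.adicCompletion L)) (latt (Matrix.diagonal ![(1 : (w.1.adicCompletion L)), 1, ϖ])))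
    {γ : Gqs L v} (hreg : IsRegularElt (γ.val : GL (Fin 3) (LocalRing L v))) (hΩ : γ ∉ hyperbolicSet L v) : {x : {M : Submodule 𝒪[(w.1.adicCompletion L)] (Fin 3 → (w.1.adicCompletion L)) // IsVertex (galAdicCompletionMap (L := L) (IsCMField.complexConj L) hw) ϖ ((StdForm.antidiagonal 3).over (w.1.adicCompletion L)) M} | a γ x = x}.Finite :=
  finite_setOf_apply_eq_self_of_isCompact_centralizer_of_involution L v w hw eA ha hvσ hϖ htr₀ htr₂ hreg
    (F0P3cStCharTSEllCartanCompact.isCompact_centralizer_of_not_mem_hyperbolicSet L v hns hreg hΩ)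

include ha in
/-- **THE JUNCTION AT THE PINS, place letters hypothesis-style**: for `γ ∈ 𝔇.ellG` the three 41g binders `hne`, `hfin`, `hfinE`. [cite: Rogawski1990, §12.5 pp. 182–187] [cite: Kottwitz1986, §3] -/
theorem ellipticFixedTree_of_mem_ellG_of_involution (hns : ∀ w' : PlacesOver L v, IsCMField.complexConj L • w'.1 = w'.1) (hvσ : ∀ x, Valued.v ((galAdicCompletionMap (L := L) (IsCMField.complexConj L) hw) x) = Valued.v x) (hϖ : Valued.v ϖ = WithZero.exp (-1 : ℤ))
    (hT : (latticeGraph (galAdicCompletionMap (L := L) (IsCMField.complexConj L) hw) ϖ ((StdForm.antidiagonal 3).over (w.1.adicCompletion L))).IsTree)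
    (htr₀ : ∀ M : Submodule 𝒪[(w.1.adicCompletion L)] (Fin 3 → (w.1.adicCompletion L)), IsSelfDualLattice (galAdicCompletionMap (L := L) (IsCMField.complexConj L) hw) ϖ ((StdForm.antidiagonal 3).over (w.1.adicCompletion L)) M → ∃ u : ↥(unitaryGroupOfForm (galAdicCompletionMap (L := L) (IsCMField.complexConj L) hw) ((StdForm.antidiagonal 3).over (w.1.adicCompletion L))), M = mapGL (u : GL (Fin 3) (w.1.adicCompletion L)) (stdLattice (w.1.adicCompletion L) 3))
    (htr₂ : ∀ M : Submodule 𝒪[(w.1.adicCompletion L)] (Fin 3 → (w.1.adicCompletion L)), IsVertexLattice (galAdicCompletionMap (L := L) (IsCMField.complexConj L) hw) ϖ ((StdForm.antidiagonal 3).over (w.1.adicCompletion L)) 2 M → ∃ u : ↥(unitaryGroupOfForm (galAdicCompletionMap (L := L) (IsCMField.complexConj L) hw) ((StdForm.antidiagonal 3).over (w.1.adicCompletion L))), M = mapGL (u : GL (Fin 3) (w.1.adicCompletion L)) (latt (Matrix.diagonal ![(1 : (w.1.adicCompletion L)), 1, ϖ])))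
    (τ : Orientation (latticeGraph (galAdicCompletionMap (L := L) (IsCMField.complexConj L) hw) ϖ ((StdForm.antidiagonal 3).over (w.1.adicCompletion L)))) (hτ : ∀ d, τ.tail d < τ.head d)
    [MeasurableSpace (Gqs L v)]
    [∀ γ : Gqs L v, MeasurableSpace (Gqs L v ⧸ Subgroup.centralizer ({γ} : Set (Gqs L v)))] [MeasurableSpace (Gqs L v ⧸ Subgroup.center (Gqs L v))]
    {H' : Type} [Group H'] [TopologicalSpace H'] [IsTopologicalGroup H'] [MeasurableSpace H']
    (𝔇 : EllipticData (Gqs L v) H')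
    (hE : ∀ γ : Gqs L v, γ ∈ 𝔇.ellG ↔ IsRegularElt (γ.val : GL (Fin 3) (UnitaryGroup.LocalRing L v)) ∧ γ ∉ hyperbolicSet L v)
    {γ : Gqs L v} (hγ : γ ∈ 𝔇.ellG) :
    (∃ o, a γ o = o) ∧ {x : {M : Submodule 𝒪[(w.1.adicCompletion L)] (Fin 3 → (w.1.adicCompletion L)) // IsVertex (galAdicCompletionMap (L := L) (IsCMField.complexConj L) hw) ϖ ((StdForm.antidiagonal 3).over (w.1.adicCompletion L)) M} | a γ x = x}.Finite ∧ {d : (latticeGraph (galAdicCompletionMap (L := L) (IsCMField.complexConj L) hw) ϖ ((StdForm.antidiagonal 3).over (w.1.adicCompletion L))).edgeSet | (a γ).mapEdgeSet d = d}.Finite := by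
  obtain ⟨hreg, hΩ⟩ := (hE γ).1 hγ
  have hfin := finite_setOf_apply_eq_self_of_not_mem_hyperbolicSet_of_involution L v w hw eA ha hns hvσ hϖ htr₀ htr₂ hreg hΩ
  exact ⟨exists_apply_eq_self_of_not_mem_hyperbolicSet_of_involution L v w hw eA ha hns hvσ hϖ hT hreg hΩ, hfin,
    finite_setOf_mapEdgeSet_eq_self_of_finite L v w hw eA ha τ hτ hfin⟩

/-! ## §2 The TAME dischargers (`_of_neg`: `σ ϖ = −ϖ`, `|2| = 1`) -/

omit eA ha in
/-- **SELF-DUAL TRANSITIVITY AT A TAME RAMIFIED PLACE** (`|2| = 1`): every self-dual vertex lattice is `u·L₀` (★ `exists_unitary_mapGL_stdLattice_eq_of_isSelfDualLattice_of_v_two`) —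
the `htr₀` letter of §1. [cite: BruhatTits1972, §10] -/
theorem forall_isSelfDualLattice_exists_mapGL_stdLattice_eq_of_v_two
    (hσ : ∀ x, (galAdicCompletionMap (L := L) (IsCMField.complexConj L) hw) ((galAdicCompletionMap (L := L) (IsCMField.complexConj L) hw) x) = x) (hvσ : ∀ x, Valued.v ((galAdicCompletionMap (L := L) (IsCMField.complexConj L) hw) x) = Valued.v x) (hϖ : Valued.v ϖ = WithZero.exp (-1 : ℤ)) (h2 : Valued.v (2 : (w.1.adicCompletion L)) = 1) :
    ∀ M : Submodule 𝒪[(w.1.adicCompletion L)] (Fin 3 → (w.1.adicCompletion L)), IsSelfDualLattice (galAdicCompletionMap (L := L) (IsCMField.complexConj L) hw) ϖ ((StdForm.antidiagonal 3).over (w.1.adicCompletion L)) M →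
      ∃ u : ↥(unitaryGroupOfForm (galAdicCompletionMap (L := L) (IsCMField.complexConj L) hw) ((StdForm.antidiagonal 3).over (w.1.adicCompletion L))), M = mapGL (u : GL (Fin 3) (w.1.adicCompletion L)) (stdLattice (w.1.adicCompletion L) 3) :=
  fun _ hM => exists_unitary_mapGL_stdLattice_eq_of_isSelfDualLattice_of_v_two hσ hvσ hϖ h2 hM

include ha in
/-- **`hne` AT A TAME RAMIFIED PLACE** (`σ ϖ = −ϖ`, `|2| = 1`; the tree by ★ `isTree_latticeGraph_three_of_neg`). [cite: Serre1980Trees, I.6.5 Prop. 26] [cite: BruhatTits1972, §10]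
[cite: Kottwitz1986, §3] -/
theorem exists_apply_eq_self_of_isCompact_centralizer_of_neg (hσ : ∀ x, (galAdicCompletionMap (L := L) (IsCMField.complexConj L) hw) ((galAdicCompletionMap (L := L) (IsCMField.complexConj L) hw) x) = x) (hvσ : ∀ x, Valued.v ((galAdicCompletionMap (L := L) (IsCMField.complexConj L) hw) x) = Valued.v x) (hϖ : Valued.v ϖ = WithZero.exp (-1 : ℤ))
    (hσϖ : (galAdicCompletionMap (L := L) (IsCMField.complexConj L) hw) ϖ = -ϖ) (hres : ∀ x : (w.1.adicCompletion L), Valued.v x ≤ 1 → Valued.v ((galAdicCompletionMap (L := L) (IsCMField.complexConj L) hw) x - x) < 1) (h2 : Valued.v (2 : (w.1.adicCompletion L)) = 1) (hnorm : ∀ u : (w.1.adicCompletion L), (galAdicCompletionMap (L := L) (IsCMField.complexConj L) hw) u = u → Valued.v (u - 1) < 1 → ∃ z : (w.1.adicCompletion L), z * (galAdicCompletionMap (L := L) (IsCMField.complexConj L) hw) z = u ∧ Valued.v (z - 1) ≤ Valued.v (u - 1))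
    {γ : Gqs L v} (hZc : IsCompact ((Subgroup.centralizer ({γ} : Set (Gqs L v))) : Set (Gqs L v))) : ∃ o, a γ o = o :=
  exists_apply_eq_self_of_isCompact_centralizer_of_involution L v w hw eA ha hvσ hϖ (isTree_latticeGraph_three_of_neg hσ hvσ hϖ hσϖ hres h2 hnorm) hZc

include ha in
/-- **`hfin` AT A TAME RAMIFIED PLACE**: `htr₀` by ★ `…_of_v_two`, `htr₂` by ★ `forall_isVertexLattice_two_exists_mapGL_N₁_eq_of_neg`. [cite: Kottwitz1986, §3] [cite: BruhatTits1972, §10] -/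
theorem finite_setOf_apply_eq_self_of_isCompact_centralizer_of_neg (hσ : ∀ x, (galAdicCompletionMap (L := L) (IsCMField.complexConj L) hw) ((galAdicCompletionMap (L := L) (IsCMField.complexConj L) hw) x) = x) (hvσ : ∀ x, Valued.v ((galAdicCompletionMap (L := L) (IsCMField.complexConj L) hw) x) = Valued.v x) (hϖ : Valued.v ϖ = WithZero.exp (-1 : ℤ))
    (hσϖ : (galAdicCompletionMap (L := L) (IsCMField.complexConj L) hw) ϖ = -ϖ) (hres : ∀ x : (w.1.adicCompletion L), Valued.v x ≤ 1 → Valued.v ((galAdicCompletionMap (L := L) (IsCMField.complexConj L) hw) x - x) < 1) (h2 : Valued.v (2 : (w.1.adicCompletion L)) = 1) (hnorm : ∀ u : (w.1.adicCompletion L), (galAdicCompletionMap (L := L) (IsCMField.complexConj L) hw) u = u → Valued.v (u - 1) < 1 → ∃ z : (w.1.adicCompletion L), z * (galAdicCompletionMap (L := L) (IsCMField.complexConj L) hw) z = u ∧ Valued.v (z - 1) ≤ Valued.v (u - 1))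
    {γ : Gqs L v} (hreg : IsRegularElt (γ.val : GL (Fin 3) (LocalRing L v))) (hZc : IsCompact ((Subgroup.centralizer ({γ} : Set (Gqs L v))) : Set (Gqs L v))) : {x : {M : Submodule 𝒪[(w.1.adicCompletion L)] (Fin 3 → (w.1.adicCompletion L)) // IsVertex (galAdicCompletionMap (L := L) (IsCMField.complexConj L) hw) ϖ ((StdForm.antidiagonal 3).over (w.1.adicCompletion L)) M} | a γ x = x}.Finite :=
  finite_setOf_apply_eq_self_of_isCompact_centralizer_of_involution L v w hw eA ha hvσ hϖ
    (forall_isSelfDualLattice_exists_mapGL_stdLattice_eq_of_v_two L v w hw hσ hvσ hϖ h2)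
    (forall_isVertexLattice_two_exists_mapGL_N₁_eq_of_neg hσ hvσ hϖ hσϖ hres h2 hnorm) hreg hZc

include ha in
/-- **THE JUNCTION AT THE PINS AT A TAME RAMIFIED PLACE**: for `γ ∈ 𝔇.ellG`, the three 41g-RAM binders `hne`, `hfin`, `hfinE` with NO hypothesis-style residue beyond the seven tame
letters `hσ hvσ hϖ hσϖ hres h2 hnorm`. [cite: Rogawski1990, §12.5 pp. 182–187] [cite: Kottwitz1986, §3] -/
theorem ellipticFixedTree_of_mem_ellG_of_neg (hns : ∀ w' : PlacesOver L v, IsCMField.complexConj L • w'.1 = w'.1) (hσ : ∀ x, (galAdicCompletionMap (L := L) (IsCMField.complexConj L) hw) ((galAdicCompletionMap (L := L) (IsCMField.complexConj L) hw) x) = x) (hvσ : ∀ x, Valued.v ((galAdicCompletionMap (L := L) (IsCMField.complexConj L) hw) x) = Valued.v x) (hϖ : Valued.v ϖ = WithZero.exp (-1 : ℤ))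
    (hσϖ : (galAdicCompletionMap (L := L) (IsCMField.complexConj L) hw) ϖ = -ϖ) (hres : ∀ x : (w.1.adicCompletion L), Valued.v x ≤ 1 → Valued.v ((galAdicCompletionMap (L := L) (IsCMField.complexConj L) hw) x - x) < 1) (h2 : Valued.v (2 : (w.1.adicCompletion L)) = 1) (hnorm : ∀ u : (w.1.adicCompletion L), (galAdicCompletionMap (L := L) (IsCMField.complexConj L) hw) u = u → Valued.v (u - 1) < 1 → ∃ z : (w.1.adicCompletion L), z * (galAdicCompletionMap (L := L) (IsCMField.complexConj L) hw) z = u ∧ Valued.v (z - 1) ≤ Valued.v (u - 1))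
    (τ : Orientation (latticeGraph (galAdicCompletionMap (L := L) (IsCMField.complexConj L) hw) ϖ ((StdForm.antidiagonal 3).over (w.1.adicCompletion L)))) (hτ : ∀ d, τ.tail d < τ.head d)
    [MeasurableSpace (Gqs L v)]
    [∀ γ : Gqs L v, MeasurableSpace (Gqs L v ⧸ Subgroup.centralizer ({γ} : Set (Gqs L v)))] [MeasurableSpace (Gqs L v ⧸ Subgroup.center (Gqs L v))]
    {H' : Type} [Group H'] [TopologicalSpace H'] [IsTopologicalGroup H'] [MeasurableSpace H']
    (𝔇 : EllipticData (Gqs L v) H')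
    (hE : ∀ γ : Gqs L v, γ ∈ 𝔇.ellG ↔ IsRegularElt (γ.val : GL (Fin 3) (UnitaryGroup.LocalRing L v)) ∧ γ ∉ hyperbolicSet L v)
    {γ : Gqs L v} (hγ : γ ∈ 𝔇.ellG) :
    (∃ o, a γ o = o) ∧ {x : {M : Submodule 𝒪[(w.1.adicCompletion L)] (Fin 3 → (w.1.adicCompletion L)) // IsVertex (galAdicCompletionMap (L := L) (IsCMField.complexConj L) hw) ϖ ((StdForm.antidiagonal 3).over (w.1.adicCompletion L)) M} | a γ x = x}.Finite ∧ {d : (latticeGraph (galAdicCompletionMap (L := L) (IsCMField.complexConj L) hw) ϖ ((StdForm.antidiagonal 3).over (w.1.adicCompletion L))).edgeSet | (a γ).mapEdgeSet d = d}.Finite :=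
  ellipticFixedTree_of_mem_ellG_of_involution L v w hw eA ha hns hvσ hϖ (isTree_latticeGraph_three_of_neg hσ hvσ hϖ hσϖ hres h2 hnorm)
    (forall_isSelfDualLattice_exists_mapGL_stdLattice_eq_of_v_two L v w hw hσ hvσ hϖ h2)
    (forall_isVertexLattice_two_exists_mapGL_N₁_eq_of_neg hσ hvσ hϖ hσϖ hres h2 hnorm) τ hτ 𝔇 hE hγ

end Datum

end Summit.HodgeConjecture.HodgeConjecture.Cruxes.H413.F0P3cStCharTSEllipticFixedTreeRamified

end
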